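import Literature.MathematicalPhysics.QuantumLattice.TorusBandParticleHole
import Literature.MathematicalPhysics.QuantumLattice.TorusCooperSum
import Literature.MathematicalPhysics.QuantumLattice.HubbardEffectiveActionCTSymmetry
import HarnessLib

/-!
# Closed shells of the even torus band hold `≡ 1 (mod 4)` momenta below the van Hove level

Family `hubbard` / topic `MathematicalPhysics/QuantumLattice`. Elementary counting facts about the free
band `ε_L(k) = -2(cos(2πk₁/L) + cos(2πk₂/L))` (`torusBand`) of the square torus `(ℤ/Lℤ)²` with EVEN `L`:

* `four_dvd_card_of_rot4` — a finite set carrying a self-map `f` with `f⁴ = id` and `f²` fixed-point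
  free has cardinality divisible by `4` (free `ℤ/4`-orbits, by induction on the set);
* `torusBand_nonneg_of_neg_eq_self` — a nonzero momentum with `-k = k` has a coordinate `L/2` and hence
  `ε_L(k) ≥ 0`: strictly below the van Hove level `k ↦ -k` fixes only `k = 0`;
* `torusLevelCount_mod_four` — for `-4 ≤ E < 0` the closed shell `{k : ε_L(k) ≤ E}` (the level count
  `torusLevelCount L E` of `TorusCooperSum.lean`) holds `≡ 1 (mod 4)` momenta: it is `{0}` plus free
  orbits of the rotation `k ↦ (-k₂, k₁)` (`rotSite`), whose square is `k ↦ -k`;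
* `sq_lt_two_mul_card_filter_torusBand_le_zero` — more than half of the zone lies at or below the van
  Hove level, `L² < 2·#{ε_L ≤ 0}` (particle–hole symmetry `2·#{ε < 0} + #{ε = 0} = L²`,
  `two_mul_card_filter_lt_neg_add_card_shell`, and `ε(L/2, 0) = 0`).

Consequence (used summit-side, `Summits/HubbardSuperconductivity/…/Theorems/JosephsonMirrorJmCuspFreeLayersNotSimple.lean`):
a shell number `n < L²/2` with `n ≢ 1 (mod 4)` is an OPEN shell of the free Fermi sea, so the free
`(2n, S^z = 0)` ground floor is degenerate.

Sources: folklore lattice-point counting for the square-lattice point group `C₄ᵥ` (D. J. Scalapino,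
Phys. Rep. 250 (1995) 329, §2) and the bipartite particle–hole symmetry of the band (E. H. Lieb,
Phys. Rev. Lett. 62 (1989) 1201). No definitions, no named facts.

## Mathlib / tree search

Tree: `torusBand_two_eq`, `torusBand_zero`, `torusLevelCount(_def)`, `rotSite`, `torusBand_rotSite`
(`HubbardEffectiveActionCTSymmetry`), `two_mul_card_filter_lt_neg_add_card_shell`. Mathlib: `ZMod.val_add`,
`ZMod.val_eq_zero`, `Finset.card_sdiff_of_subset`, `Nat.strong_induction_on`; no `MulAction` orbit
machinery is needed.
-/

noncomputable section

namespace Literature.MathematicalPhysics.QuantumLattice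

open Finset Real Literature.Probability.LatticeModels

/-! ### Free `ℤ/4`-orbits -/

/-- **Free `ℤ/4`-orbit count.** If `f` maps the finite set `S` into itself, `f⁴ = id` on `S` and
`f²` has no fixed point in `S`, then `4 ∣ #S` (remove the orbit `{a, fa, f²a, f³a}` of any `a ∈ S`,
which has four elements and whose complement is again `f`-stable, and induct). [folklore] -/
theorem four_dvd_card_of_rot4 {α : Type*} [DecidableEq α] (f : α → α) (S : Finset α)
    (hmap : ∀ a ∈ S, f a ∈ S) (h4 : ∀ a ∈ S, f (f (f (f a))) = a) (h2 : ∀ a ∈ S, f (f a) ≠ a) :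
    4 ∣ S.card := by
  induction' hn : S.card using Nat.strong_induction_on with n ih generalizing S
  rcases S.eq_empty_or_nonempty with hS | ⟨a, ha⟩
  · subst hn; simp [hS]
  · have ha1 : f a ∈ S := hmap a ha
    have ha2 : f (f a) ∈ S := hmap _ ha1
    have hne1 : ∀ x ∈ S, f x ≠ x := fun x hx h => h2 x hx (by rw [h, h])
    have d01 : a ≠ f a := fun h => hne1 a ha h.symm
    have d02 : a ≠ f (f a) := fun h => h2 a ha h.symm
    have d03 : a ≠ f (f (f a)) := by
      intro h
      apply hne1 a ha
      have h' := h4 a ha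
      rw [← h] at h'
      exact h'
    have d12 : f a ≠ f (f a) := fun h => hne1 (f a) ha1 h.symm
    have d13 : f a ≠ f (f (f a)) := fun h => h2 (f a) ha1 h.symm
    have d23 : f (f a) ≠ f (f (f a)) := fun h => hne1 (f (f a)) ha2 h.symm
    set O : Finset α := {a, f a, f (f a), f (f (f a))} with hO
    have hOS : O ⊆ S := by
      intro x hx
      simp only [hO, mem_insert, mem_singleton] at hx
      rcases hx with rfl | rfl | rfl | rfl
      · exact ha
      · exact ha1
      · exact ha2
      · exact hmap _ ha2
    have hOcard : O.card = 4 := by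
      rw [hO, card_insert_of_notMem, card_insert_of_notMem, card_insert_of_notMem, card_singleton]
      · simpa using d23
      · simp [d12, d13]
      · simp [d01, d02, d03]
    have hOf : ∀ x ∈ O, f x ∈ O := by
      intro x hx
      simp only [hO, mem_insert, mem_singleton] at hx ⊢
      rcases hx with rfl | rfl | rfl | rfl
      · simp
      · simp
      · simp
      · exact Or.inl (h4 a ha)
    set S' : Finset α := S \ O with hS'
    have hcardS' : S'.card = S.card - 4 := by
      rw [hS', card_sdiff_of_subset hOS, hOcard]
    have hle : 4 ≤ S.card := hOcard ▸ card_le_card hOS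
    have hlt : S'.card < n := by rw [hcardS']; omega
    have hmap' : ∀ x ∈ S', f x ∈ S' := by
      intro x hx
      rw [hS', mem_sdiff] at hx ⊢
      refine ⟨hmap x hx.1, fun hfx => hx.2 ?_⟩
      rw [← h4 x hx.1]
      exact hOf _ (hOf _ (hOf _ hfx))
    have h4' : ∀ x ∈ S', f (f (f (f x))) = x := fun x hx => h4 x (mem_sdiff.1 hx).1
    have h2' : ∀ x ∈ S', f (f x) ≠ x := fun x hx => h2 x (mem_sdiff.1 hx).1
    have hdiv : 4 ∣ S'.card := ih S'.card hlt S' hmap' h4' h2' rfl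
    have hS4 : S.card = S'.card + 4 := by rw [hcardS']; omega
    rw [← hn, hS4]
    exact Dvd.dvd.add hdiv (dvd_refl 4)

/-! ### The even torus band: momenta fixed by `k ↦ -k`, the rotation, closed shells mod 4 -/

section Band

variable {L : ℕ} [NeZero L]

/-- In `ℤ/Lℤ` with `L` even, `x + x = 0` forces `x = 0` or `x = L/2` (on representatives).
[folklore] -/
theorem zmod_val_eq_half_of_add_self_eq_zero (hL : Even L) (x : ZMod L) (hx : x + x = 0)
    (hx0 : x ≠ 0) : x.val = L / 2 := by
  obtain ⟨m, hm⟩ := hL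
  have hval : (x + x).val = 0 := by rw [hx, ZMod.val_zero]
  rw [ZMod.val_add] at hval
  have hlt := ZMod.val_lt x
  obtain ⟨c, hc⟩ := Nat.dvd_of_mod_eq_zero hval
  have hxv : x.val ≠ 0 := fun h => hx0 ((ZMod.val_eq_zero x).1 h)
  rcases c with _ | _ | c
  · omega
  · omega
  · rw [show L * (c + 1 + 1) = L * c + 2 * L by ring] at hc
    omega

/-- The lattice cosine at the representative `L/2` of an even torus is `cos π = -1`. [folklore] -/
theorem cos_two_pi_mul_half_div (hL : Even L) :
    Real.cos (2 * π * ((L / 2 : ℕ) : ℝ) / L) = -1 := by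
  obtain ⟨m, hm⟩ := hL
  have hm0 : 0 < m := by
    have := Nat.pos_of_ne_zero (NeZero.ne L); omega
  have h2 : L / 2 = m := by omega
  rw [h2, show (L : ℝ) = 2 * m by rw [hm]; push_cast; ring]
  have hmr : (m : ℝ) ≠ 0 := by exact_mod_cast hm0.ne'
  rw [show 2 * π * (m : ℝ) / (2 * m) = π by field_simp]
  exact Real.cos_pi

/-- A momentum with a coordinate at the zone boundary `L/2` (even `L`) is not below the van Hove
level: `ε_L(k) ≥ 0`. [folklore] -/
theorem torusBand_nonneg_of_val_eq_half (hL : Even L) (k : TorusSite 2 L) (i : Fin 2)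
    (hi : (k i).val = L / 2) : 0 ≤ torusBand L k := by
  have hc := cos_two_pi_mul_half_div (L := L) hL
  rw [torusBand_two_eq]
  have hb0 := Real.cos_le_one (2 * π * ((k 0).val : ℝ) / L)
  have hb1 := Real.cos_le_one (2 * π * ((k 1).val : ℝ) / L)
  fin_cases i
  · simp only [Fin.zero_eta] at hi
    rw [hi, hc]; linarith
  · simp only [Fin.mk_one] at hi
    rw [hi, hc]; linarith

/-- **Momenta strictly below the van Hove level are not fixed by `k ↦ -k`** (even `L`), except
`k = 0`: if `-k = k` and `k ≠ 0` then some coordinate is `L/2` and `ε_L(k) ≥ 0`. [folklore] -/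
theorem torusBand_nonneg_of_neg_eq_self (hL : Even L) {k : TorusSite 2 L} (hk : -k = k)
    (hk0 : k ≠ 0) : 0 ≤ torusBand L k := by
  have hcoord : ∀ i : Fin 2, k i + k i = 0 := fun i => by
    have h := congrFun hk i
    rw [Pi.neg_apply, neg_eq_iff_add_eq_zero] at h
    exact h
  -- some coordinate is nonzero
  have hex : ∃ i : Fin 2, k i ≠ 0 := by
    by_contra h
    push Not at h
    exact hk0 (funext fun i => by rw [h i]; rfl)
  obtain ⟨i, hi⟩ := hex
  exact torusBand_nonneg_of_val_eq_half hL k i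
    (zmod_val_eq_half_of_add_self_eq_zero hL (k i) (hcoord i) hi)

omit [NeZero L] in
/-- Two rotations are the inversion: `rot (rot k) = -k`. [folklore] -/
theorem rotSite_rotSite_eq_neg (k : TorusSite 2 L) : rotSite (rotSite k) = -k := by
  funext i
  fin_cases i <;> rfl

omit [NeZero L] in
/-- `rot k = 0` only for `k = 0`. [folklore] -/
theorem rotSite_ne_zero {k : TorusSite 2 L} (hk : k ≠ 0) : rotSite k ≠ 0 := by
  intro h
  apply hk
  have h0 : (rotSite k) 0 = 0 := by rw [h]; rfl
  have h1 : (rotSite k) 1 = 0 := by rw [h]; rfl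
  funext i
  fin_cases i
  · exact h1
  · have : -k 1 = 0 := h0
    simpa using this

/-- **Closed shells below the van Hove level hold `≡ 1 (mod 4)` momenta.** For even `L` and
`-4 ≤ E < 0`: `#{k : ε_L(k) ≤ E} ≡ 1 (mod 4)` — the set is `{0}` plus free orbits of the rotation
`k ↦ (-k₂, k₁)` (whose square `k ↦ -k` fixes no nonzero momentum below the van Hove level).
[folklore] -/
theorem torusLevelCount_mod_four (hL : Even L) {E : ℝ} (hE4 : -4 ≤ E) (hE : E < 0) :
    torusLevelCount L E % 4 = 1 := by
  classical
  rw [torusLevelCount_def]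
  set S : Finset (TorusSite 2 L) := univ.filter fun k => torusBand L k ≤ E with hS
  have h0S : (0 : TorusSite 2 L) ∈ S := by
    rw [hS, mem_filter]
    refine ⟨mem_univ _, ?_⟩
    rw [torusBand_zero]; push_cast; linarith
  set S' := S.erase 0 with hS'
  have hmemS' : ∀ k, k ∈ S' ↔ k ≠ 0 ∧ torusBand L k ≤ E := fun k => by
    rw [hS', mem_erase, hS, mem_filter]; simp
  have hdiv : 4 ∣ S'.card := by
    refine four_dvd_card_of_rot4 rotSite S' ?_ ?_ ?_
    · intro k hk
      rw [hmemS'] at hk ⊢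
      exact ⟨rotSite_ne_zero hk.1, by rw [torusBand_rotSite]; exact hk.2⟩
    · intro k _
      rw [rotSite_rotSite_eq_neg, rotSite_rotSite_eq_neg, neg_neg]
    · intro k hk h
      rw [hmemS'] at hk
      rw [rotSite_rotSite_eq_neg] at h
      have := torusBand_nonneg_of_neg_eq_self hL h hk.1
      linarith [hk.2]
  have hcard : S.card = S'.card + 1 := by
    rw [hS', card_erase_of_mem h0S, Nat.sub_add_cancel (card_pos.2 ⟨0, h0S⟩)]
  rw [hcard]
  omega

/-- The momentum `(L/2, 0)` of the even torus sits AT the van Hove level: `ε = 0`. [folklore] -/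
theorem torusBand_half_zero_eq_zero (hL : Even L) :
    torusBand L (![((L / 2 : ℕ) : ZMod L), 0] : TorusSite 2 L) = 0 := by
  have hLpos : 0 < L := Nat.pos_of_ne_zero (NeZero.ne L)
  have hval : (((L / 2 : ℕ) : ZMod L)).val = L / 2 := by
    rw [ZMod.val_natCast, Nat.mod_eq_of_lt (Nat.div_lt_self hLpos one_lt_two)]
  rw [torusBand_two_eq]
  simp only [Matrix.cons_val_zero, Matrix.cons_val_one, Matrix.cons_val_fin_one, hval, ZMod.val_zero,
    Nat.cast_zero, mul_zero, zero_div, Real.cos_zero, cos_two_pi_mul_half_div hL]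
  ring

/-- **More than half of the even zone is at or below the van Hove level**:
`L² < 2 · #{k : ε_L(k) ≤ 0}` (`2·#{ε < 0} + #{ε = 0} = L²` by particle–hole symmetry, and `ε = 0`
is attained at `(L/2, 0)`). [folklore] -/
theorem sq_lt_two_mul_card_filter_torusBand_le_zero (hL : Even L) :
    L ^ 2 < 2 * (univ.filter fun k : TorusSite 2 L => torusBand L k ≤ 0).card := by
  classical
  have h := two_mul_card_filter_lt_neg_add_card_shell (L := L) hL (le_refl (0 : ℝ))
  -- split `ε ≤ 0` into `ε < 0` and `ε = 0`
  have hsplit : (univ.filter fun k : TorusSite 2 L => torusBand L k ≤ 0).card =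
      (univ.filter fun k : TorusSite 2 L => torusBand L k < -0).card +
        (univ.filter fun k : TorusSite 2 L => |torusBand L k - 0| ≤ 0).card := by
    rw [← card_union_of_disjoint]
    · congr 1
      ext k
      simp only [mem_filter, mem_univ, true_and, mem_union, neg_zero, sub_zero, abs_nonpos_iff]
      constructor
      · intro hk
        rcases lt_or_eq_of_le hk with h' | h'
        · exact Or.inl h'
        · exact Or.inr h'
      · rintro (h' | h')
        · exact h'.le
        · exact h'.le
    · rw [disjoint_filter]
      intro k _ hk
      rw [neg_zero] at hk
      rw [sub_zero, abs_nonpos_iff]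
      exact hk.ne
  have hzero : 1 ≤ (univ.filter fun k : TorusSite 2 L => |torusBand L k - 0| ≤ 0).card := by
    refine card_pos.2 ⟨![((L / 2 : ℕ) : ZMod L), 0], ?_⟩
    rw [mem_filter]
    exact ⟨mem_univ _, by rw [sub_zero, torusBand_half_zero_eq_zero hL, abs_zero]⟩
  omega

end Band


end Literature.MathematicalPhysics.QuantumLattice

end
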